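import Literature.Barriers.NavierStokesRegularity.HypodissipativeLerayNonuniquenessLocal
import Literature.Analysis.FluidPDE.FractionalNSPrescribedEnergyFamiliesProofs
import HarnessLib

/-!
# Colombo–De Lellis–De Rosa 2018, Thms. 1.2–1.3 from the convex-integration iteration (Prop. 3.2)

Fourth sibling proof file (theorems only, no definitions, no notation) of the barrier entry
`Literature/Barriers/NavierStokesRegularity/HypodissipativeLerayNonuniqueness` (D-0021). The
sibling `HypodissipativeLerayNonuniquenessLocal` proves Thm. 1.3 and Thm. 1.2 of Colombo–De
Lellis–De Rosa (2018) from their Prop. 2.2 (`Literature.Analysis.FluidPDE.ColomboDeLellisDeRosa2018_prop22`);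
the Analysis/FluidPDE file `FractionalNSPrescribedEnergyFamiliesProofs` now proves Prop. 2.2 from
the iteration Prop. 3.2 run universally (§8.3), the named fact
`Literature.Analysis.FluidPDE.ColomboDeLellisDeRosa2018_prop32` of
`FractionalNSPrescribedEnergyIteration` (the construction of §§4–8 of the paper, its
research-level core). Composing the two, the CDLDR theorems rest on that single named fact:

* `ColomboDeLellisDeRosa2018_thm13_of_prop32` — Thm. 1.3 (local `C^β` non-uniqueness with the
  energy inequality) from Prop. 3.2;
* `ColomboDeLellisDeRosa2018_thm12_of_prop32` — Thm. 1.2 (infinitely many Leray solutions from one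
  `L²` datum, `α < 1/5`) from Prop. 3.2 (Thm. 1.1, Cor. 11.2, the profile family, the
  continuation remark and the passage to the limit all being proved in the tree).

## References

* M. Colombo, C. De Lellis, L. De Rosa, *Ill-posedness of Leray solutions for the hypodissipative
  Navier–Stokes equations*, Comm. Math. Phys. 362 (2018), 659–688 (held: arXiv:1708.05666): §1
  Thms. 1.2–1.3; §2 Prop. 2.2 and the proof of Thm. 1.3; §3 Prop. 3.2; §8.3.
  [`ColomboDelellisDerosa2018`]
-/

noncomputable section

open Literature.Analysis.FluidPDE

namespace Literature.Barriers.NavierStokesRegularity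

/-- **Colombo–De Lellis–De Rosa 2018, Thm. 1.3 from the iteration Prop. 3.2** (run universally
as in §8.3): `ColomboDeLellisDeRosa2018_thm13_of_prop22` composed with the proved passage to the
limit `ColomboDeLellisDeRosa2018_prop22_of_prop32`.
[cite: ColomboDelellisDerosa2018, §2 (proof of Thm. 1.3) and §8.3 (proof of Prop. 2.2)] -/
theorem ColomboDeLellisDeRosa2018_thm13_of_prop32 (h32 : ColomboDeLellisDeRosa2018_prop32) :
    ColomboDeLellisDeRosa2018_thm13 :=
  ColomboDeLellisDeRosa2018_thm13_of_prop22 (ColomboDeLellisDeRosa2018_prop22_of_prop32 h32)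

/-- **Colombo–De Lellis–De Rosa 2018, Thm. 1.2 from the iteration Prop. 3.2**: for `α < 1/5`
some divergence-free `v̄ ∈ L²(𝕋³)` carries infinitely many Leray solutions
(`ColomboDeLellisDeRosa2018_thm12`), GIVEN only the convex-integration iteration
`ColomboDeLellisDeRosa2018_prop32` (everything else in the printed chain Prop. 3.2 ⇒ Prop. 2.2 ⇒
Thm. 1.3 ⇒ Thm. 1.2 is proved in the tree).
[cite: ColomboDelellisDerosa2018, §1 p. 3, §2 pp. 5–6, §8.3 pp. 18–19] -/
theorem ColomboDeLellisDeRosa2018_thm12_of_prop32 (h32 : ColomboDeLellisDeRosa2018_prop32) :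
    ColomboDeLellisDeRosa2018_thm12 :=
  ColomboDeLellisDeRosa2018_thm12_of_prop22 (ColomboDeLellisDeRosa2018_prop22_of_prop32 h32)

end Literature.Barriers.NavierStokesRegularity
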